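import Literature.Geometry.Lorentzian.AFSobolev
import Literature.Geometry.Lorentzian.MassCapacityProofs
import Literature.Geometry.Lorentzian.EnergyCurrents
import Literature.Geometry.Lorentzian.ConnectionNaturality
import HarnessLib

/-!
# The extended coordinate radius `r'` of a one-ended asymptotically flat manifold

Schoen–Yau, Comm. Math. Phys. 65 (1979), p. 52 (Step 3 of the proof of Theorem 1): *"we let
`r'` be a smooth function on `N` which agrees with the Euclidean distance to the origin `r` on
`N_k` outside a compact set, and is `≥ 1` everywhere"*; with (1.1) one has `‖∇r'‖² ≤ C₃` on the
end (p. 54) and hence on all of `N`. This file constructs such a function on a manifold `X` with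
one asymptotically flat end `e` (`e.IsSoleEnd`) whose metric satisfies `h − δ = O₂(r^{−α})`,
`α > 0` (`AFEnd.IsMetricAsymptoticallyFlat`, implied by (1.1)):

* `AFEnd.exists_smooth_properRadius` — there are a `C^∞` function `ρ : X → ℝ`, a radius `R₁ > R`
  and a constant `C₃` with `ρ ≥ 1`, `|∇ρ|²_h ≤ C₃` everywhere, `ρ = ‖coord‖` on the far region
  `far R₁`, and all sublevel sets `{ρ ≤ t}` compact (`ρ` is proper).

The construction is `ρ = 1 + S(‖coord‖ − R₁)(‖coord‖ − 1)` with Mathlib's `Real.smoothTransition`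
`S` (so `ρ = 1` on the core and for `‖coord‖ ≤ R₁`, `ρ = ‖coord‖` for `‖coord‖ ≥ R₁ + 1`), the
gradient bound on the end being the chart estimate `|∇(F ∘ coord)|²_h ≤ 2 ‖DF‖²` where
`‖h_{ij} − δ_{ij}‖ ≤ ½` (`AFEnd.gradSq_comp_coord_le`, the argument of
`AFEnd.gradNorm_endCutoff_sq_le` in `MassCapacityProofs.lean` for a general profile `F`).
Everything is proved; no definitions, no named facts.

## References

* R. Schoen, S.-T. Yau, *On the proof of the positive mass conjecture in general relativity*,
  Comm. Math. Phys. 65 (1979) 45–76, §2, Step 3, p. 52 and p. 54. [SchoenYauPMT1979]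
-/

noncomputable section

open Set Filter Function Topology Manifold
open scoped ContDiff Manifold

namespace Literature.Geometry.Lorentzian

namespace AFEnd

variable {X : Type} [TopologicalSpace X] [ChartedSpace E3 X] [IsManifold (𝓡 3) ∞ X]
  (e : AFEnd X) (D : InitialDataSet (𝓡 3) X)

/-! ### The radial profile `F(y) = 1 + S(‖y‖ − R₁)(‖y‖ − 1)` on `ℝ³` -/

section Profile

variable {R₁ : ℝ}

/-- The profile `F(y) = 1 + S(‖y‖ − R₁)(‖y‖ − 1)` is smooth on `ℝ³` (`R₁ > 0`): near the ball
`‖y‖ < R₁` it is the constant `1`, elsewhere a product of smooth functions. [folklore] -/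
theorem contDiff_radiusProfile (hR₁ : 0 < R₁) :
    ContDiff ℝ ∞ fun y : E3 ↦ 1 + Real.smoothTransition (‖y‖ - R₁) * (‖y‖ - 1) := by
  refine contDiff_const.add (contDiff_iff_contDiffAt.2 fun y ↦ ?_)
  by_cases hy : ‖y‖ < R₁
  · have hev : (fun y : E3 ↦ Real.smoothTransition (‖y‖ - R₁) * (‖y‖ - 1)) =ᶠ[𝓝 y]
        fun _ ↦ 0 :=
      Filter.eventuallyEq_of_mem ((isOpen_lt continuous_norm continuous_const).mem_nhds hy)
        fun z hz ↦ by
          rw [Real.smoothTransition.zero_of_nonpos (by linarith [hz.out]), zero_mul]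
    exact contDiffAt_const.congr_of_eventuallyEq hev
  · have hy0 : y ≠ 0 := by
      rintro rfl
      exact hy (by simpa using hR₁)
    exact (contDiff_smoothTransition_norm_sub hR₁).contDiffAt.mul
      ((contDiffAt_norm ℝ hy0).sub contDiffAt_const)

/-- `F = 1` on the closed ball `‖y‖ ≤ R₁`. [folklore] -/
theorem radiusProfile_eq_one {y : E3} (hy : ‖y‖ ≤ R₁) :
    1 + Real.smoothTransition (‖y‖ - R₁) * (‖y‖ - 1) = 1 := by
  rw [Real.smoothTransition.zero_of_nonpos (by linarith), zero_mul, add_zero]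

/-- `F = ‖·‖` where `‖y‖ ≥ R₁ + 1`. [folklore] -/
theorem radiusProfile_eq_norm {y : E3} (hy : R₁ + 1 ≤ ‖y‖) :
    1 + Real.smoothTransition (‖y‖ - R₁) * (‖y‖ - 1) = ‖y‖ := by
  rw [Real.smoothTransition.one_of_one_le (by linarith), one_mul, add_sub_cancel]

/-- `1 ≤ F` (`R₁ ≥ 1`). [folklore] -/
theorem one_le_radiusProfile (hR₁ : 1 ≤ R₁) (y : E3) :
    1 ≤ 1 + Real.smoothTransition (‖y‖ - R₁) * (‖y‖ - 1) := by
  by_cases hy : 1 ≤ ‖y‖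
  · have := Real.smoothTransition.nonneg (‖y‖ - R₁)
    nlinarith
  · rw [radiusProfile_eq_one (by linarith)]

/-- `1 ≤ F ≤ max 1 ‖y‖`-type control: `F y ≤ ‖y‖` where `‖y‖ ≥ 1`. [folklore] -/
theorem radiusProfile_le_norm {y : E3} (hy : 1 ≤ ‖y‖) :
    1 + Real.smoothTransition (‖y‖ - R₁) * (‖y‖ - 1) ≤ ‖y‖ := by
  have := Real.smoothTransition.le_one (‖y‖ - R₁)
  nlinarith

/-- **A global bound for `‖DF‖`** (`R₁ > 0`): by continuity on the compact ball `‖y‖ ≤ R₁ + 2`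
and `‖D‖·‖‖ = 1` beyond `R₁ + 1`, where `F = ‖·‖`. [folklore] -/
theorem exists_bound_fderiv_radiusProfile (hR₁ : 0 < R₁) :
    ∃ C : ℝ, 0 ≤ C ∧ ∀ y : E3,
      ‖fderiv ℝ (fun y : E3 ↦ 1 + Real.smoothTransition (‖y‖ - R₁) * (‖y‖ - 1)) y‖ ≤ C := by
  set F : E3 → ℝ := fun y ↦ 1 + Real.smoothTransition (‖y‖ - R₁) * (‖y‖ - 1) with hF
  have hFs : ContDiff ℝ ∞ F := contDiff_radiusProfile hR₁
  obtain ⟨C₀, hC₀⟩ := (isCompact_closedBall (0 : E3) (R₁ + 2)).exists_bound_of_continuousOn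
    (hFs.continuous_fderiv (by simp)).continuousOn
  refine ⟨max C₀ 1, le_max_of_le_right zero_le_one, fun y ↦ ?_⟩
  by_cases hy : ‖y‖ ≤ R₁ + 2
  · exact (hC₀ y (mem_closedBall_zero_iff.2 hy)).trans (le_max_left _ _)
  · -- beyond `R₁ + 1`, `F = ‖·‖` locally
    have hy1 : R₁ + 1 < ‖y‖ := by linarith [not_le.1 hy]
    have hev : F =ᶠ[𝓝 y] fun z ↦ ‖z‖ :=
      Filter.eventuallyEq_of_mem ((isOpen_lt continuous_const continuous_norm).mem_nhds hy1)
        fun z hz ↦ radiusProfile_eq_norm (le_of_lt hz)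
    rw [hev.fderiv_eq]
    have h1 : ‖fderiv ℝ (fun z : E3 ↦ ‖z‖) y‖ ≤ (1 : NNReal) :=
      norm_fderiv_le_of_lipschitz ℝ lipschitzWith_one_norm
    exact (h1.trans_eq NNReal.coe_one).trans (le_max_right _ _)

end Profile

/-! ### On the manifold: `ρ = F ∘ coord` -/

section OnManifold

variable {R₁ : ℝ}

omit [IsManifold (𝓡 3) ∞ X] in
/-- Off the closed far piece `{q ∈ U | R₁ ≤ ‖coord q‖}`, `ρ = 1 + S(‖coord‖ − R₁)(‖coord‖ − 1)`
is locally the constant `1` (the cut-off factor is locally zero there,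
`endCutoff_eventuallyEq_zero`). [folklore] -/
theorem radius_eventuallyEq_one (hR₁ : e.R < R₁) {q : X}
    (hq : q ∉ ((↑) : e.U → X) '' (e.chart ⁻¹' {x | R₁ ≤ ‖(x : E3)‖})) :
    (fun q ↦ 1 + Real.smoothTransition (‖e.coord q‖ - R₁) * (‖e.coord q‖ - 1)) =ᶠ[𝓝 q]
      fun _ ↦ (1 : ℝ) := by
  filter_upwards [e.endCutoff_eventuallyEq_zero hR₁ hq] with p hp
  rw [hp, zero_mul, add_zero]

omit [IsManifold (𝓡 3) ∞ X] in
/-- **`ρ` is smooth on `X`** (`R₁ > R`): on the end it is the smooth profile of the smooth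
coordinate function, off the closed far piece it is locally constant. [folklore] -/
theorem contMDiff_radius (hR₁ : e.R < R₁) :
    ContMDiff (𝓡 3) 𝓘(ℝ, ℝ) ∞
      (fun q ↦ 1 + Real.smoothTransition (‖e.coord q‖ - R₁) * (‖e.coord q‖ - 1)) := by
  intro q
  by_cases hq : q ∈ ((↑) : e.U → X) '' (e.chart ⁻¹' {x | R₁ ≤ ‖(x : E3)‖})
  · obtain ⟨hqU, -⟩ := e.mem_image_preimage_le_norm_iff.1 hq
    exact (contDiff_radiusProfile (e.R_pos.trans hR₁)).comp_contMDiffAt (e.contMDiffAt_coord hqU)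
  · exact contMDiffAt_const.congr_of_eventuallyEq (e.radius_eventuallyEq_one hR₁ hq)

/-- **Chart estimate for the gradient of a radial function on the end**: if `F : ℝ³ → ℝ` is
smooth with `‖DF‖ ≤ C` and `‖h_{ij}(coord q) − δ_{ij}‖ ≤ ½` at a point `q` of the end, then
`|∇(F ∘ coord)|²_h(q) ≤ 2C²` (with `β = d(F∘coord)_q`, `v = ♯β`, `c = dcoord_q v`:
`|∇|² = β v = h(v,v) = h_{ij}cⁱcʲ ≥ ½‖c‖²` and `β v = DF(coord q) c ≤ C‖c‖`). The argument of
`gradNorm_endCutoff_sq_le` (`MassCapacityProofs.lean`) for a general profile; Schoen–Yau 1979,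
p. 54: "Because of (1.1), there is a constant `C₃` with `‖∇r‖² ≤ C₃`". [folklore] -/
theorem gradSq_comp_coord_le {F : E3 → ℝ} (hF : ContDiff ℝ ∞ F) {C : ℝ} (hC : 0 ≤ C)
    (hderiv : ∀ y, ‖fderiv ℝ F y‖ ≤ C) {q : X} (hqU : q ∈ e.U)
    (hclose : ‖hCoeff e D (e.coord q) - (innerSL ℝ : E3 →L[ℝ] E3 →L[ℝ] ℝ)‖ ≤ 1 / 2) :
    D.metric.gradSq (F ∘ e.coord) q ≤ 2 * C ^ 2 := by
  set χ : X → ℝ := F ∘ e.coord with hχ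
  set β : Module.Dual ℝ (TangentSpace (𝓡 3) q) :=
    (mvfderiv (𝓡 3) χ q : TangentSpace (𝓡 3) q →ₗ[ℝ] ℝ) with hβ
  set v : TangentSpace (𝓡 3) q := D.metric.sharp q β with hv
  set c : E3 := mfderiv (𝓡 3) 𝓘(ℝ, E3) e.coord q v with hc
  have hsq : D.metric.gradSq χ q = β v := rfl
  have hvv : D.metric.val q v v = β v := PseudoRiemannianMetric.val_sharp_apply D.metric q β v
  have hcoord : hCoeff e D (e.coord q) c c = D.metric.val q v v :=
    e.hCoeff_coord_mfderiv D ⟨q, hqU⟩ v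
  have hlow : 1 / 2 * ‖c‖ ^ 2 ≤ β v := by
    rw [← hvv, ← hcoord]
    exact half_norm_sq_le_hCoeff (e := e) (D := D) hclose c
  -- chain rule: `β v = DF(coord q) c ≤ C ‖c‖`
  have hchain : β v = fderiv ℝ F (e.coord q) c := by
    have hcd : MDifferentiableAt (𝓡 3) 𝓘(ℝ, E3) e.coord q :=
      (e.contMDiffAt_coord hqU).mdifferentiableAt (by simp)
    have hFd : MDifferentiableAt 𝓘(ℝ, E3) 𝓘(ℝ, ℝ) F (e.coord q) :=
      ((hF.differentiable (by simp)) _).mdifferentiableAt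
    show mvfderiv (𝓡 3) (F ∘ e.coord) q v = _
    rw [PseudoRiemannianMetric.mvfderiv_comp_apply (Φ := e.coord) hFd hcd v]
    simp only [mvfderiv, ContinuousLinearMap.comp_apply, mfderiv_eq_fderiv]
    rfl
  have hup : β v ≤ C * ‖c‖ := by
    rw [hchain]
    exact (le_abs_self _).trans ((Real.norm_eq_abs _).symm.le.trans
      (((fderiv ℝ F (e.coord q)).le_opNorm c).trans (mul_le_mul_of_nonneg_right (hderiv _)
        (norm_nonneg _))))
  rw [hsq]
  have hc2 : ‖c‖ ≤ 2 * C := by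
    by_cases hc0 : ‖c‖ = 0
    · rw [hc0]; positivity
    · have hcpos : 0 < ‖c‖ := (norm_nonneg _).lt_of_ne (Ne.symm hc0)
      nlinarith
  nlinarith [norm_nonneg c]

/-- **Schoen–Yau's extended radius `r'`** (Comm. Math. Phys. 65 (1979), p. 52: "let `r'` be a
smooth function on `N` which agrees with the Euclidean distance to the origin `r` on `N_k`
outside a compact set, and is `≥ 1` everywhere"; p. 54: "`‖∇r‖² ≤ C₃`"). On a manifold with
one asymptotically flat end (`e.IsSoleEnd`, `h − δ = O₂(r^{−α})` with `α > 0`) there are a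
smooth `ρ : X → ℝ`, a radius `R₂ > R` and a constant `C₃` with: `ρ ≥ 1`; `|∇ρ|²_h ≤ C₃` on all of
`X`; every sublevel set `{ρ ≤ t}` compact; and `ρ = ‖coord‖` on the far region `far R₂`.
(`ρ = 1 + S(‖coord‖ − R₁)(‖coord‖ − 1)` for a large `R₁`.)
[cite: SchoenYauPMT1979, §2, Step 3, p. 52] -/
theorem exists_smooth_properRadius {α : ℝ} (hα : 0 < α) (hAF : e.IsMetricAsymptoticallyFlat D α)
    (hsole : e.IsSoleEnd) :
    ∃ (ρ : X → ℝ) (R₂ C₃ : ℝ), e.R < R₂ ∧ ContMDiff (𝓡 3) 𝓘(ℝ, ℝ) ∞ ρ ∧ (∀ q, 1 ≤ ρ q) ∧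
      (∀ q, D.metric.gradSq ρ q ≤ C₃) ∧ (∀ t : ℝ, IsCompact {q | ρ q ≤ t}) ∧
      (∀ q ∈ e.far R₂, ρ q = ‖e.coord q‖) := by
  obtain ⟨R₀, hR₀⟩ := exists_radius_hCoeff_sub_innerSL_le (e := e) (D := D) hα hAF
  set R₁ : ℝ := max (max e.R R₀) 1 + 1 with hR₁
  have hR₁R : e.R < R₁ := by
    have := (le_max_left e.R R₀).trans (le_max_left (max e.R R₀) 1); linarith
  have hR₁0 : R₀ ≤ R₁ := by
    have := (le_max_right e.R R₀).trans (le_max_left (max e.R R₀) 1); linarith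
  have hR₁1 : 1 ≤ R₁ := by have := le_max_right (max e.R R₀) 1; linarith
  have hR₁pos : 0 < R₁ := e.R_pos.trans hR₁R
  set F : E3 → ℝ := fun y ↦ 1 + Real.smoothTransition (‖y‖ - R₁) * (‖y‖ - 1) with hF
  have hFs : ContDiff ℝ ∞ F := contDiff_radiusProfile hR₁pos
  obtain ⟨C, hC, hCF⟩ := exists_bound_fderiv_radiusProfile (R₁ := R₁) hR₁pos
  have hρs : ContMDiff (𝓡 3) 𝓘(ℝ, ℝ) ∞ (fun q ↦ F (e.coord q)) := e.contMDiff_radius hR₁R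
  refine ⟨fun q ↦ F (e.coord q), R₁ + 1, 2 * C ^ 2, by linarith, hρs,
    fun q ↦ one_le_radiusProfile hR₁1 _, fun q ↦ ?_, fun t ↦ ?_, fun q hq ↦ ?_⟩
  · by_cases hq : q ∈ ((↑) : e.U → X) '' (e.chart ⁻¹' {x | R₁ ≤ ‖(x : E3)‖})
    · obtain ⟨hqU, hqR⟩ := e.mem_image_preimage_le_norm_iff.1 hq
      exact e.gradSq_comp_coord_le D hFs hC hCF hqU (hR₀ _ (hR₁0.trans hqR))
    · have h0 : mvfderiv (𝓡 3) (fun q ↦ F (e.coord q)) q = 0 :=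
        mvfderiv_eq_zero_of_eventuallyEq_const (e.radius_eventuallyEq_one hR₁R hq)
      have : D.metric.gradSq (fun q ↦ F (e.coord q)) q = 0 := by
        rw [PseudoRiemannianMetric.gradSq_eq, h0]
        simp
      rw [this]
      positivity
  · refine (isCompact_compl_far hsole (max t (R₁ + 1))).of_isClosed_subset
      (isClosed_le hρs.continuous continuous_const) fun q (hq : F (e.coord q) ≤ t) hfar ↦ ?_
    obtain ⟨-, hqn⟩ := e.mem_far_iff_coord.1 hfar
    have h1 : R₁ + 1 ≤ ‖e.coord q‖ := (le_max_right _ _).trans hqn.le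
    have hρq : F (e.coord q) = ‖e.coord q‖ := radiusProfile_eq_norm h1
    have ht : t < ‖e.coord q‖ := (le_max_left _ _).trans_lt hqn
    linarith
  · obtain ⟨-, hqn⟩ := e.mem_far_iff_coord.1 hq
    exact radiusProfile_eq_norm hqn.le

end OnManifold

end AFEnd

end Literature.Geometry.Lorentzian

end
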